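import Summits.HodgeConjecture.HodgeConjecture.Theorems.NoetherLefschetzOneUpK3TypeNetsOddPrimeSquares
import Literature.AlgebraicGeometry.Surfaces.K3Marking

/-!
# Route MarkmanPartnerTransport · crux `PicardThreeK3Squares` (stmt-HodgeConjecture-19652) —
# the ODD-PRIME-RANK Picard numbers `ρ ∈ {3, 5, 9, 11, 15, 19}` WITHOUT Buskin's theorem

`Theorems/…RealMultiplicationRanksCorollaries` (gen 0) records HC⁴(S ⊗ S) at the Picard numbers
`ρ ∈ {3, 5, 9, 11, 15, 17, 18, 19, 20}` (no real multiplication there: `22 − ρ ≠ e·m`, `e ≥ 2`, `m ≥ 3`)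
MODULO Buskin's Thm. 1.1 (the CM case) and markings. At the six Picard numbers with `22 − ρ` an ODD
PRIME (`19, 17, 13, 11, 7, 3`) Buskin is not needed: a CM field has even degree, so `End_Hdg(T(S)) = ℚ`
(the tree's KERNEL theorem `OddPrimeSquares.hodgeConjectureFor_square_of_isK3Surface_of_prime`, van
Geemen's Lemma 3.2 / Zarhin), and the only input left is `b₂(S) = 22`, read off a marking. This file
records that upgrade:

* `hodgeConjectureFor_square_of_marking_of_rank_prime` — for a K3 surface with a marking
  `η : H²(S(ℂ); ℂ) ≃ ℂ²²` and `22 − ρ(S)` an odd prime, HC⁴(S ⊗ S) (no named fact at all).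
* `hodgeConjectureFor_square_of_picard_mem_oddPrimeRanks` — for every projective K3 surface with
  `ρ(S) ∈ {3, 5, 9, 11, 15, 19}`, HC⁴(S ⊗ S) modulo `Huybrechts_K3_marking_exists` ONLY.

No definition, no sorry. Prover seat hodge-nonav-19652-p1 (gen 4), `--supports stmt-HodgeConjecture-19652`.

References: B. van Geemen, Michigan Math. J. 56 (2008), Lemma 3.2; Yu. G. Zarhin, J. reine angew. Math.
341 (1983), Thm. 1.5.1; D. Huybrechts, *Lectures on K3 Surfaces*, Ch. 1 §3.3, Ch. 3 Rem. 3.3.14 (ii).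
-/

set_option linter.dupNamespace false

noncomputable section

namespace Summit.HodgeConjecture.HodgeConjecture.Theorems.MarkmanPartnerTransport.OddPrimeRanks

open CategoryTheory MonoidalCategory
open Literature.AlgebraicGeometry Literature.AlgebraicGeometry.Motives Literature.AlgebraicGeometry.HodgeTheory
open Literature.AlgebraicGeometry.Surfaces
open Literature.AlgebraicTopology.SingularHomology

variable {S : SchemeOver ℂ}

/-- **HC⁴(S ⊗ S) for a K3 surface with a marking and `22 − ρ(S)` an odd prime — no named fact.**
`η` gives `b₂(S) = 22`, so `rk T(S) = 22 − ρ(S)` is an odd prime and the tree's KERNEL theorem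
`OddPrimeSquares.hodgeConjectureFor_square_of_isK3Surface_of_prime` (`End_Hdg(T(S)) = ℚ`: no real or
complex multiplication in odd prime rank) applies. [cite: Vangeemen2008, Lemma 3.2]
[cite: Huybrechts2016K3, Ch. 3 Rem. 3.3.14 (ii) and Ch. 1 §3.3] -/
theorem hodgeConjectureFor_square_of_marking_of_rank_prime (hK3 : IsK3Surface S)
    (η : complexBetti S (2 * 1) ≃ₗ[ℂ] (K3Index → ℂ))
    (hp : (22 - Module.finrank ℂ ↥(algebraicClasses S 1)).Prime)
    (hodd : Odd (22 - Module.finrank ℂ ↥(algebraicClasses S 1))) :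
    HodgeConjectureFor 4 (S ⊗ S) := by
  have h22 : Module.finrank ℂ (complexBetti S (2 * 1)) = 22 := by
    rw [η.finrank_eq, Module.finrank_fintype_fun_eq_card]
    rfl
  exact OddPrimeSquares.hodgeConjectureFor_square_of_isK3Surface_of_prime hK3 (by rw [h22]; exact hp)
    (by rw [h22]; exact hodd)

/-- **HC⁴(S ⊗ S) for every projective K3 surface of Picard number `ρ(S) ∈ {3, 5, 9, 11, 15, 19}`,
modulo `Huybrechts_K3_marking_exists` ONLY** (Buskin's Thm. 1.1 is NOT used: at these ranks
`rk T(S) ∈ {19, 17, 13, 11, 7, 3}` is an odd prime, so `End_Hdg(T(S)) = ℚ`). Upgrades the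
`ρ ∈ {3, 5, 9, 11, 15, 19}` part of `RealMultiplicationRanks.hodgeConjectureFor_square_of_picard_mem`.
[cite: Vangeemen2008, Lemma 3.2] [cite: Zarhin1983HodgeGroupsK3, Thm. 1.5.1]
[cite: Huybrechts2016K3, Ch. 3 Rem. 3.3.14 (ii)] -/
theorem hodgeConjectureFor_square_of_picard_mem_oddPrimeRanks (hmark : Huybrechts_K3_marking_exists)
    (hK3 : IsK3Surface S)
    (hρ : Module.finrank ℂ ↥(algebraicClasses S 1) ∈ ({3, 5, 9, 11, 15, 19} : Finset ℕ)) :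
    HodgeConjectureFor 4 (S ⊗ S) := by
  obtain ⟨η, -, -, -⟩ := hmark S hK3
  refine hodgeConjectureFor_square_of_marking_of_rank_prime hK3 η ?_ ?_
  · simp only [Finset.mem_insert, Finset.mem_singleton] at hρ
    rcases hρ with h | h | h | h | h | h <;> rw [h] <;> norm_num
  · simp only [Finset.mem_insert, Finset.mem_singleton] at hρ
    rcases hρ with h | h | h | h | h | h <;> rw [h] <;> decide

/-- **The crux restricted to the odd-prime-rank Picard numbers holds modulo markings only** — VERBATIM
the binders of `PicardThreeK3Squares` (marked projective K3 surfaces), plus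
«`ρ(S) ∈ {3, 5, 9, 11, 15, 19}`»; the marking in the binders supplies `b₂ = 22`, so NO named fact is
used. [cite: Vangeemen2008, Lemma 3.2] [cite: Huybrechts2016K3, Ch. 3 Rem. 3.3.14 (ii)] -/
theorem picardThreeK3Squares_restricted_to_oddPrimeRanks :
    ∀ (S : SchemeOver ℂ), IsK3Surface S →
      ∀ (η : complexBetti S (2 * 1) ≃ₗ[ℂ] (K3Index → ℂ)),
        Module.finrank ℂ ↥(algebraicClasses S 1) ∈ ({3, 5, 9, 11, 15, 19} : Finset ℕ) →
        HodgeConjectureFor 4 (S ⊗ S) := by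
  intro S hK3 η hρ
  refine hodgeConjectureFor_square_of_marking_of_rank_prime hK3 η ?_ ?_
  · simp only [Finset.mem_insert, Finset.mem_singleton] at hρ
    rcases hρ with h | h | h | h | h | h <;> rw [h] <;> norm_num
  · simp only [Finset.mem_insert, Finset.mem_singleton] at hρ
    rcases hρ with h | h | h | h | h | h <;> rw [h] <;> decide

end Summit.HodgeConjecture.HodgeConjecture.Theorems.MarkmanPartnerTransport.OddPrimeRanks

end
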